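import Literature.Computability.Complexity.MajorityEnumeration
import Literature.Computability.Complexity.EncodingFrames
import HarnessLib

/-!
# Bit codecs: fixed-length binary encodings of finite types, with their parsing maps

Trunk toolkit. A reduction written in the `FP` string algebra reads its coins and inputs as
concatenations of fixed-length blocks, while its analysis is a count over a product of finite types;
the two are related by an encoding `enc : α → {0,1}^len` together with a TOTAL parser
`dec : {0,1}* → α` inverting it on `{0,1}^len`. This file packages that data once:

* `BitCodec α` — `len`, `enc`, `dec`, `length_enc`, `dec_enc`, `enc_dec` (on strings of length `len`);
  `equiv : α ≃ List.Vector Bool len`, `card_eq : |α| = 2^len`, `enc_injective`, and the change of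
  variables `sum_vector_eq : ∑_{v ∈ {0,1}^len} g v = ∑_{a} g (enc a)`;
* constructions: `vector k` (bit vectors, `enc = toList`), `prod` (concatenation / `take`-`drop`),
  `pi c t` (`t` consecutive blocks, `Fin t → α`, via `ccat`), `finPow a` (`Fin (2^a)` as little-endian
  numerals `natBits`/`bitsToNat` of `StackUnaryBits.lean`), `ofEquiv` (transport along an equivalence);
  each with its `enc`/`dec` computation rules.

## References

* S. Arora, B. Barak, *Computational Complexity: A Modern Approach*, CUP 2009, §0.1 ("Representing
  objects as strings", pairs and tuples by concatenation of fixed-length codes).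
-/

namespace Literature.Computability.Complexity

open _root_.Computability

/-- A fixed-length binary code of `α` with a total parser inverting it on strings of the right length.
[cite: AroraBarakCC2009, §0.1] -/
structure BitCodec (α : Type*) where
  /-- the code length -/
  len : ℕ
  /-- the encoder -/
  enc : α → List Bool
  /-- the (total) parser -/
  dec : List Bool → α
  /-- codes have length `len` -/
  length_enc : ∀ a, (enc a).length = len
  /-- parsing a code returns the object -/
  dec_enc : ∀ a, dec (enc a) = a
  /-- every string of length `len` is the code of what it parses to -/
  enc_dec : ∀ l, l.length = len → enc (dec l) = l

namespace BitCodec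

variable {α β : Type*}

/-- The encoder is injective. [folklore] -/
theorem enc_injective (c : BitCodec α) : Function.Injective c.enc := fun a b h => by
  rw [← c.dec_enc a, h, c.dec_enc]

/-- The code as an equivalence with `{0,1}^len`. [folklore] -/
def equiv (c : BitCodec α) : α ≃ List.Vector Bool c.len where
  toFun a := ⟨c.enc a, c.length_enc a⟩
  invFun v := c.dec v.toList
  left_inv a := c.dec_enc a
  right_inv v := List.Vector.toList_injective (by simpa using c.enc_dec v.toList (List.Vector.toList_length v))

/-- `(c.equiv a).toList = c.enc a`. [folklore] -/
@[simp] theorem equiv_apply_toList (c : BitCodec α) (a : α) : (c.equiv a).toList = c.enc a := rfl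

/-- `c.equiv.symm v = c.dec v.toList`. [folklore] -/
@[simp] theorem equiv_symm_apply (c : BitCodec α) (v : List.Vector Bool c.len) : c.equiv.symm v = c.dec v.toList := rfl

/-- **`|α| = 2^len`.** [folklore] -/
theorem card_eq [Fintype α] (c : BitCodec α) : Fintype.card α = 2 ^ c.len := by
  rw [Fintype.card_congr c.equiv, card_vector, Fintype.card_bool]

/-- **Change of variables**: summing over `{0,1}^len` is summing over `α` through the encoder. [folklore] -/
theorem sum_vector_eq [Fintype α] {M : Type*} [AddCommMonoid M] (c : BitCodec α) (g : List Bool → M) :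
    ∑ v : List.Vector Bool c.len, g v.toList = ∑ a : α, g (c.enc a) :=
  (Fintype.sum_equiv c.equiv (fun a => g (c.enc a)) (fun v => g v.toList) fun _ => rfl).symm

/-- Counting strings of length `len` with a property = counting objects. [folklore] -/
theorem card_filter_vector_eq [Fintype α] (c : BitCodec α) (P : List Bool → Prop) [DecidablePred P] :
    ((Finset.univ : Finset (List.Vector Bool c.len)).filter fun v => P v.toList).card =
      ((Finset.univ : Finset α).filter fun a => P (c.enc a)).card := by
  rw [← Finset.card_map c.equiv.toEmbedding]
  congr 1
  ext v
  simp only [Finset.mem_map_equiv, Finset.mem_filter, Finset.mem_univ, true_and]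
  constructor
  · intro h; simpa [c.enc_dec v.toList (List.Vector.toList_length v)] using h
  · intro h
    have := c.enc_dec v.toList (List.Vector.toList_length v)
    simp only [equiv_symm_apply] at h
    rwa [this] at h

/-! ### Constructions -/

/-- Bit vectors of length `k`, coded by themselves (the parser cuts and pads). [folklore] -/
def vector (k : ℕ) : BitCodec (List.Vector Bool k) where
  len := k
  enc v := v.toList
  dec l := ⟨l.take k ++ List.replicate (k - l.length) false, by
    simp only [List.length_append, List.length_take, List.length_replicate]; omega⟩
  length_enc v := List.Vector.toList_length v
  dec_enc v := List.Vector.toList_injective (by simp)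
  enc_dec l hl := by
    subst hl
    show l.take l.length ++ List.replicate (l.length - l.length) false = l
    simp

/-- `(vector k).enc = toList`. [folklore] -/
@[simp] theorem vector_enc (k : ℕ) (v : List.Vector Bool k) : (vector k).enc v = v.toList := rfl
/-- `(vector k).len = k`. [folklore] -/
@[simp] theorem vector_len (k : ℕ) : (vector k).len = k := rfl
/-- Parsing a string of length `k` as a vector gives the string back. [folklore] -/
theorem vector_dec_toList (k : ℕ) {l : List Bool} (hl : l.length = k) : ((vector k).dec l).toList = l :=
  (vector k).enc_dec l hl

/-- Pairs, coded by concatenation; parsed by `take`/`drop`. [cite: AroraBarakCC2009, §0.1] -/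
def prod (c₁ : BitCodec α) (c₂ : BitCodec β) : BitCodec (α × β) where
  len := c₁.len + c₂.len
  enc p := c₁.enc p.1 ++ c₂.enc p.2
  dec l := (c₁.dec (l.take c₁.len), c₂.dec (l.drop c₁.len))
  length_enc p := by rw [List.length_append, c₁.length_enc, c₂.length_enc]
  dec_enc p := by
    rw [List.take_append_of_le_length (c₁.length_enc p.1).ge, List.take_of_length_le (c₁.length_enc p.1).le,
      List.drop_append_of_le_length (c₁.length_enc p.1).ge, List.drop_of_length_le (c₁.length_enc p.1).le,
      List.nil_append, c₁.dec_enc, c₂.dec_enc]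
  enc_dec l hl := by
    show c₁.enc (c₁.dec (l.take c₁.len)) ++ c₂.enc (c₂.dec (l.drop c₁.len)) = l
    rw [c₁.enc_dec _ (by rw [List.length_take]; omega), c₂.enc_dec _ (by rw [List.length_drop]; omega),
      List.take_append_drop]

/-- `(prod c₁ c₂).enc (a, b) = enc a ++ enc b`. [folklore] -/
@[simp] theorem prod_enc (c₁ : BitCodec α) (c₂ : BitCodec β) (p : α × β) : (prod c₁ c₂).enc p = c₁.enc p.1 ++ c₂.enc p.2 := rfl
/-- `(prod c₁ c₂).len = len₁ + len₂`. [folklore] -/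
@[simp] theorem prod_len (c₁ : BitCodec α) (c₂ : BitCodec β) : (prod c₁ c₂).len = c₁.len + c₂.len := rfl
/-- `(prod c₁ c₂).dec l = (dec (l ↾ len₁), dec (l ⇂ len₁))`. [folklore] -/
@[simp] theorem prod_dec (c₁ : BitCodec α) (c₂ : BitCodec β) (l : List Bool) :
    (prod c₁ c₂).dec l = (c₁.dec (l.take c₁.len), c₂.dec (l.drop c₁.len)) := rfl

/-- The length of a concatenation of `m`-bit blocks (local form of a standard `ccat` fact). [folklore] -/
theorem length_ccat_blocks {g : ℕ → List Bool} {m : ℕ} : ∀ {k : ℕ}, (∀ i, i < k → (g i).length = m) → (ccat g k).length = k * m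
  | 0, _ => by simp
  | k + 1, h => by
    rw [ccat_succ, List.length_append, length_ccat_blocks (fun i hi => h i (by omega)), h k (by omega)]; ring

/-- Block `b` of a concatenation of `m`-bit blocks. [folklore] -/
theorem ccat_block {g : ℕ → List Bool} {m : ℕ} :
    ∀ {k : ℕ}, (∀ i, i < k → (g i).length = m) → ∀ {b : ℕ}, b < k → ((ccat g k).drop (b * m)).take m = g b
  | 0, _, b, hb => by omega
  | k + 1, h, b, hb => by
    have hlen := length_ccat_blocks (fun i (hi : i < k) => h i (Nat.lt_succ_of_lt hi))
    rw [ccat_succ]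
    rcases Nat.lt_succ_iff_lt_or_eq.1 hb with hb' | rfl
    · rw [List.drop_append_of_le_length (by rw [hlen]; exact Nat.mul_le_mul_right _ hb'.le),
        List.take_append_of_le_length (by rw [List.length_drop, hlen, ← Nat.sub_mul]; exact Nat.le_mul_of_pos_left _ (by omega))]
      exact ccat_block (fun i hi => h i (by omega)) hb'
    · rw [List.drop_left' hlen, List.take_of_length_le (by rw [h b (by omega)])]

/-- A string of length `k·m` is the concatenation of its `m`-bit blocks. [folklore] -/
theorem ccat_of_blocks {m : ℕ} : ∀ {k : ℕ} {w : List Bool}, w.length = k * m → ccat (fun b => (w.drop (b * m)).take m) k = w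
  | 0, w, hw => by simpa using hw
  | k + 1, w, hw => by
    rw [ccat_succ]
    have hlt : (w.take (k * m)).length = k * m := by rw [List.length_take, min_eq_left]; rw [hw]; nlinarith
    conv_rhs => rw [← List.take_append_drop (k * m) w]
    congr 1
    · rw [← ccat_of_blocks (w := w.take (k * m)) hlt]
      refine ccat_congr fun b hb => ?_
      rw [List.drop_take, List.take_take, min_eq_left]
      rw [← Nat.sub_mul]; exact Nat.le_mul_of_pos_left _ (by omega)
    · rw [List.take_of_length_le]
      rw [List.length_drop, hw]; apply le_of_eq; ring_nf; omega

/-- `t`-tuples `Fin t → α`, coded by `t` consecutive blocks. [cite: AroraBarakCC2009, §0.1] -/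
def pi (c : BitCodec α) (t : ℕ) : BitCodec (Fin t → α) where
  len := t * c.len
  enc w := ccat (fun b => if h : b < t then c.enc (w ⟨b, h⟩) else []) t
  dec l := fun b => c.dec ((l.drop (b * c.len)).take c.len)
  length_enc w := length_ccat_blocks fun i hi => by rw [dif_pos hi, c.length_enc]
  dec_enc w := by
    funext b
    rw [ccat_block (fun i hi => by rw [dif_pos hi, c.length_enc]) b.isLt, dif_pos b.isLt, c.dec_enc]
  enc_dec l hl := by
    conv_rhs => rw [← ccat_of_blocks hl]
    refine ccat_congr fun b hb => ?_
    rw [dif_pos hb, c.enc_dec _ (by rw [List.length_take, List.length_drop, hl, min_eq_left]; rw [← Nat.sub_mul]; exact Nat.le_mul_of_pos_left _ (by omega))]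

/-- `(pi c t).len = t · len`. [folklore] -/
@[simp] theorem pi_len (c : BitCodec α) (t : ℕ) : (pi c t).len = t * c.len := rfl
/-- Component `b` of a parsed tuple is the parse of block `b`. [folklore] -/
@[simp] theorem pi_dec (c : BitCodec α) (t : ℕ) (l : List Bool) (b : Fin t) :
    (pi c t).dec l b = c.dec ((l.drop (b * c.len)).take c.len) := rfl
/-- The code of a tuple, as a `ccat`. [folklore] -/
theorem pi_enc (c : BitCodec α) (t : ℕ) (w : Fin t → α) :
    (pi c t).enc w = ccat (fun b => if h : b < t then c.enc (w ⟨b, h⟩) else []) t := rfl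
/-- Block `b` of the code of a tuple is the code of component `b`. [folklore] -/
theorem pi_enc_block (c : BitCodec α) (t : ℕ) (w : Fin t → α) (b : Fin t) :
    (((pi c t).enc w).drop (b * c.len)).take c.len = c.enc (w b) := by
  rw [pi_enc, ccat_block (fun i hi => by rw [dif_pos hi, c.length_enc]) b.isLt, dif_pos b.isLt]

/-- `Fin (2^a)`, coded by `a`-bit little-endian numerals. [cite: AroraBarakCC2009, §0.1] -/
def finPow (a : ℕ) : BitCodec (Fin (2 ^ a)) where
  len := a
  enc i := natBits a i
  dec l := ⟨bitsToNat (l.take a) % 2 ^ a, Nat.mod_lt _ (Nat.two_pow_pos a)⟩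
  length_enc i := length_natBits a i
  dec_enc i := by
    apply Fin.ext
    show bitsToNat ((natBits a i).take a) % 2 ^ a = i
    rw [List.take_of_length_le (length_natBits a i).le, bitsToNat_natBits i.isLt, Nat.mod_eq_of_lt i.isLt]
  enc_dec l hl := by
    show natBits a (bitsToNat (l.take a) % 2 ^ a) = l
    rw [List.take_of_length_le hl.le, Nat.mod_eq_of_lt (hl ▸ bitsToNat_lt l), ← hl, CoinEnum.natBits_bitsToNat]

/-- `(finPow a).len = a`. [folklore] -/
@[simp] theorem finPow_len (a : ℕ) : (finPow a).len = a := rfl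
/-- Parsing an `a`-bit string gives its numeral. [folklore] -/
theorem finPow_dec_val (a : ℕ) {l : List Bool} (hl : l.length = a) : ((finPow a).dec l : ℕ) = bitsToNat l := by
  show bitsToNat (l.take a) % 2 ^ a = bitsToNat l
  rw [List.take_of_length_le hl.le, Nat.mod_eq_of_lt (hl ▸ bitsToNat_lt l)]
/-- The numeral of the code of `i` is `i`. [folklore] -/
theorem bitsToNat_finPow_enc (a : ℕ) (i : Fin (2 ^ a)) : bitsToNat ((finPow a).enc i) = i := bitsToNat_natBits i.isLt

/-- Transport of a codec along an equivalence. [folklore] -/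
def ofEquiv (c : BitCodec α) (e : α ≃ β) : BitCodec β where
  len := c.len
  enc b := c.enc (e.symm b)
  dec l := e (c.dec l)
  length_enc b := c.length_enc _
  dec_enc b := by rw [c.dec_enc, Equiv.apply_symm_apply]
  enc_dec l hl := by rw [Equiv.symm_apply_apply, c.enc_dec l hl]

/-- `(ofEquiv c e).enc b = c.enc (e.symm b)`. [folklore] -/
@[simp] theorem ofEquiv_enc (c : BitCodec α) (e : α ≃ β) (b : β) : (ofEquiv c e).enc b = c.enc (e.symm b) := rfl
/-- `(ofEquiv c e).dec l = e (c.dec l)`. [folklore] -/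
@[simp] theorem ofEquiv_dec (c : BitCodec α) (e : α ≃ β) (l : List Bool) : (ofEquiv c e).dec l = e (c.dec l) := rfl
/-- `(ofEquiv c e).len = c.len`. [folklore] -/
@[simp] theorem ofEquiv_len (c : BitCodec α) (e : α ≃ β) : (ofEquiv c e).len = c.len := rfl

end BitCodec

end Literature.Computability.Complexity
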